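import Mathlib
import HarnessLib

/-!
# Hubbard ladder — Bounds: exact Brillouin-zone integrals and the kinetic symbol of the `t`–`t′` class

HONEST FRAMING (cell pub-hubbard): ladder R1–R4 with certified numbers; no claim on H/H₀. These
are bounds for MODEL CLASSES; no materials claim. This file is pure real analysis plus definitions:
the elementary integrals behind the thermodynamic-limit constants of the one-body (bathtub)
kinetic-weight ceiling of `pub-hubbard/paper/bounds.tex` (Thm. "one-body ceiling", Cor. "ceilings
for 𝒦", Remark "finite-`L` versus thermodynamic limit") for the square-lattice `t`–`t′` class, and the
objects about which `Bounds/BandwidthExtremiser.lean` proves the extremiser theorem.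

## Content (all sorry-free)

1. Exact values: `integral_abs_cos` (`∫_{-π}^{π} |cos| = 4`); `integral_abs_cos_sub_cos`
   (`∫_{-π}^{π} |cos x − cos b| dx = 4 sin b + 2(π − 2b) cos b` for `b ∈ [0, π]`);
   `integral_abs_cos_add_cos` (inner integral of `|cos x + cos y|`);
   `integral_integral_abs_cos_add_cos` (`∫_{-π}^{π}∫_{-π}^{π} |cos x + cos y| dx dy = 32`, whence the
   half-filled nearest-neighbour kinetic energy `8t/π²` per site and spin);
   `integral_integral_abs_cos_mul_cos` (`∫∫ |cos x cos y| = 16`).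
2. A small API for iterated zone integrals `bzInt f = ∫_{-π}^{π} ∫_{-π}^{π} f x y dx dy` of continuous
   `f`: `bzInt_mono`, `bzInt_add`, `bzInt_const_mul`, continuity of the inner integral and of sections,
   and the reflection `∫_{-π}^{π} F(π − y) dy = ∫_{-π}^{π} F` for `2π`-periodic `F`
   (`integral_comp_pi_sub_of_periodic`), which implements the zone shift `k ↦ k + (π, π)`.
3. Definitions for the `t`–`t′` class (units `t = 1`, `s = t′/t`; dictionary to `bounds.tex` in the header
   of `Bounds/BandwidthExtremiser.lean`): the kinetic symbol
   `kinSymbol s k₁ k₂ = 2(cos k₁ + cos k₂) + 8 s cos k₁ cos k₂` (= `w(k)` of `bounds.tex` Cor. "ceilings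
   for 𝒦" at `t = 1`), its zone-averaged `L¹` mass `kinL1 s = (2π)⁻² bzInt |kinSymbol s|`, its bandwidth
   `kinBandwidth s = max 8 (4 + 16|s|)` and the merit `merit s = 4 kinL1 s / kinBandwidth s`; pointwise
   identities (`kinSymbol_affine`, the `(π, π)`-shift `kinSymbol_pi_sub`, `abs_kinSymbol_neg`) and
   continuity.

References: E. H. Lieb, M. Loss, *Analysis* (2001), Thm 1.14 (bathtub); Hazra–Verma–Randeria,
Phys. Rev. X 9, 031049 (2019), App. A (the kinetic-energy estimate these constants make exact).
-/

namespace Summit.HubbardSuperconductivity.HubbardLadder.Bounds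

open Real Set MeasureTheory intervalIntegral

noncomputable section

/-! ## 1. Exact one-dimensional and iterated integrals -/

/-- `∫_{-π}^{π} |cos x| dx = 4`. -/
theorem integral_abs_cos : ∫ x in (-π)..π, |cos x| = 4 := by
  have hi : ∀ a b : ℝ, IntervalIntegrable (fun x => |cos x|) volume a b :=
    fun a b => (continuous_abs.comp continuous_cos).intervalIntegrable a b
  have hπ := pi_pos
  have h1 : ∫ x in (-π)..(-(π / 2)), |cos x| = 1 := by
    have : ∫ x in (-π)..(-(π / 2)), |cos x| = ∫ x in (-π)..(-(π / 2)), -cos x := by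
      refine integral_congr fun x hx => ?_
      rw [uIcc_of_le (by linarith)] at hx
      have hc : cos x ≤ 0 := by
        rw [← Real.cos_neg]
        exact cos_nonpos_of_pi_div_two_le_of_le (by linarith [hx.2]) (by linarith [hx.1])
      simp [abs_of_nonpos hc]
    rw [this, intervalIntegral.integral_neg, integral_cos]
    norm_num [Real.sin_neg, Real.sin_pi_div_two, Real.sin_pi]
  have h2 : ∫ x in (-(π / 2))..(π / 2), |cos x| = 2 := by
    have : ∫ x in (-(π / 2))..(π / 2), |cos x| = ∫ x in (-(π / 2))..(π / 2), cos x := by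
      refine integral_congr fun x hx => ?_
      rw [uIcc_of_le (by linarith)] at hx
      simp [abs_of_nonneg (cos_nonneg_of_mem_Icc hx)]
    rw [this, integral_cos]
    norm_num [Real.sin_neg, Real.sin_pi_div_two]
  have h3 : ∫ x in (π / 2)..π, |cos x| = 1 := by
    have : ∫ x in (π / 2)..π, |cos x| = ∫ x in (π / 2)..π, -cos x := by
      refine integral_congr fun x hx => ?_
      rw [uIcc_of_le (by linarith)] at hx
      have hc : cos x ≤ 0 := cos_nonpos_of_pi_div_two_le_of_le hx.1 (by linarith [hx.2])
      simp [abs_of_nonpos hc]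
    rw [this, intervalIntegral.integral_neg, integral_cos]
    norm_num [Real.sin_pi_div_two, Real.sin_pi]
  have e1 := integral_add_adjacent_intervals (hi (-π) (-(π / 2))) (hi (-(π / 2)) (π / 2))
  have e2 := integral_add_adjacent_intervals (hi (-π) (π / 2)) (hi (π / 2) π)
  linarith

/-- `∫_{-π}^{π} |cos x − cos b| dx = 4 sin b + 2(π − 2b) cos b` for `b ∈ [0, π]` (split at `±b`). -/
theorem integral_abs_cos_sub_cos {b : ℝ} (hb0 : 0 ≤ b) (hbπ : b ≤ π) :
    ∫ x in (-π)..π, |cos x - cos b| = 4 * sin b + 2 * (π - 2 * b) * cos b := by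
  have hi : ∀ c d : ℝ, IntervalIntegrable (fun x => |cos x - cos b|) volume c d :=
    fun c d => (continuous_abs.comp (continuous_cos.sub continuous_const)).intervalIntegrable c d
  have hic : ∀ c d : ℝ, IntervalIntegrable (fun x => cos x) volume c d :=
    fun c d => continuous_cos.intervalIntegrable c d
  have hik : ∀ c d : ℝ, IntervalIntegrable (fun _ => cos b) volume c d :=
    fun c d => continuous_const.intervalIntegrable c d
  have hmid : ∀ x ∈ Icc (-b) b, 0 ≤ cos x - cos b := by
    intro x hx
    have h1 : cos b ≤ cos |x| :=
      cos_le_cos_of_nonneg_of_le_pi (abs_nonneg x) hbπ (abs_le.2 ⟨hx.1, hx.2⟩)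
    rw [Real.cos_abs] at h1
    linarith
  have hright : ∀ x ∈ Icc b π, cos x - cos b ≤ 0 := by
    intro x hx
    have := cos_le_cos_of_nonneg_of_le_pi hb0 hx.2 hx.1
    linarith
  have hleft : ∀ x ∈ Icc (-π) (-b), cos x - cos b ≤ 0 := by
    intro x hx
    have h := cos_le_cos_of_nonneg_of_le_pi hb0 (by linarith [hx.1] : -x ≤ π) (by linarith [hx.2])
    rw [Real.cos_neg] at h
    linarith
  have e1 : ∫ x in (-π)..(-b), |cos x - cos b| = (π - b) * cos b + sin b := by
    have : ∫ x in (-π)..(-b), |cos x - cos b| = ∫ x in (-π)..(-b), (cos b - cos x) := by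
      refine integral_congr fun x hx => ?_
      rw [uIcc_of_le (by linarith)] at hx
      simp only [abs_of_nonpos (hleft x hx)]
      ring
    rw [this, integral_sub (hik _ _) (hic _ _), intervalIntegral.integral_const, integral_cos]
    simp only [smul_eq_mul, Real.sin_neg, Real.sin_pi, neg_zero, sub_neg_eq_add, sub_zero]
    ring
  have e2 : ∫ x in (-b)..b, |cos x - cos b| = 2 * sin b - 2 * b * cos b := by
    have : ∫ x in (-b)..b, |cos x - cos b| = ∫ x in (-b)..b, (cos x - cos b) := by
      refine integral_congr fun x hx => ?_
      rw [uIcc_of_le (by linarith)] at hx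
      simp only [abs_of_nonneg (hmid x hx)]
    rw [this, integral_sub (hic _ _) (hik _ _), intervalIntegral.integral_const, integral_cos]
    simp only [smul_eq_mul, Real.sin_neg, sub_neg_eq_add]
    ring
  have e3 : ∫ x in b..π, |cos x - cos b| = (π - b) * cos b + sin b := by
    have : ∫ x in b..π, |cos x - cos b| = ∫ x in b..π, (cos b - cos x) := by
      refine integral_congr fun x hx => ?_
      rw [uIcc_of_le hbπ] at hx
      simp only [abs_of_nonpos (hright x hx)]
      ring
    rw [this, integral_sub (hik _ _) (hic _ _), intervalIntegral.integral_const, integral_cos]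
    simp only [smul_eq_mul, Real.sin_pi, zero_sub]
    ring
  have a1 := integral_add_adjacent_intervals (hi (-π) (-b)) (hi (-b) b)
  have a2 := integral_add_adjacent_intervals (hi (-π) b) (hi b π)
  linarith

/-- The inner integral: `∫_{-π}^{π} |cos x + cos y| dx = 4 sin|y| + 2(π − 2|y|) cos y`, `y ∈ [-π, π]`. -/
theorem integral_abs_cos_add_cos {y : ℝ} (hy : y ∈ Icc (-π) π) :
    ∫ x in (-π)..π, |cos x + cos y| = 4 * sin |y| + 2 * (π - 2 * |y|) * cos y := by
  have hay : |y| ≤ π := abs_le.2 ⟨hy.1, hy.2⟩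
  have hcos : cos y = -cos (π - |y|) := by rw [Real.cos_pi_sub, Real.cos_abs]; ring
  have h := integral_abs_cos_sub_cos (b := π - |y|) (by linarith) (by linarith [abs_nonneg y])
  have hf : (fun x => |cos x + cos y|) = fun x => |cos x - cos (π - |y|)| := by
    funext x
    congr 1
    rw [hcos]
    ring
  rw [hf, h, Real.sin_pi_sub, Real.cos_pi_sub, Real.cos_abs]
  ring

/-- `∫_{-π}^{π} ∫_{-π}^{π} |cos x + cos y| dx dy = 32`. -/
theorem integral_integral_abs_cos_add_cos :
    ∫ y in (-π)..π, ∫ x in (-π)..π, |cos x + cos y| = 32 := by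
  have hπ := pi_pos
  have step1 : ∫ y in (-π)..π, ∫ x in (-π)..π, |cos x + cos y| =
      ∫ y in (-π)..π, (4 * sin |y| + 2 * (π - 2 * |y|) * cos y) := by
    refine integral_congr fun y hy => ?_
    rw [uIcc_of_le (by linarith)] at hy
    exact integral_abs_cos_add_cos hy
  rw [step1]
  have hi : ∀ c d : ℝ,
      IntervalIntegrable (fun y => 4 * sin |y| + 2 * (π - 2 * |y|) * cos y) volume c d := by
    intro c d
    apply Continuous.intervalIntegrable
    fun_prop
  have hpos : ∫ y in (0:ℝ)..π, (4 * sin |y| + 2 * (π - 2 * |y|) * cos y) = 16 := by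
    have : ∫ y in (0:ℝ)..π, (4 * sin |y| + 2 * (π - 2 * |y|) * cos y) =
        ∫ y in (0:ℝ)..π, (4 * sin y + 2 * (π - 2 * y) * cos y) := by
      refine integral_congr fun y hy => ?_
      rw [uIcc_of_le hπ.le] at hy
      rw [abs_of_nonneg hy.1]
    rw [this]
    have hG : ∀ y ∈ uIcc (0:ℝ) π, HasDerivAt (fun y => -8 * cos y + 2 * ((π - 2 * y) * sin y))
        (4 * sin y + 2 * (π - 2 * y) * cos y) y := by
      intro y _
      have h1 := (hasDerivAt_cos y).const_mul (-8)
      have h2 : HasDerivAt (fun y => π - 2 * y) (-2) y := by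
        simpa using ((hasDerivAt_id y).const_mul 2).const_sub π
      have h3 := (h2.fun_mul (hasDerivAt_sin y)).const_mul 2
      refine (h1.fun_add h3).congr_deriv ?_
      ring
    rw [integral_eq_sub_of_hasDerivAt hG
      ((by fun_prop : Continuous fun y => 4 * sin y + 2 * (π - 2 * y) * cos y).intervalIntegrable
        0 π)]
    norm_num [Real.cos_pi, Real.sin_pi]
  have hneg : ∫ y in (-π)..(0:ℝ), (4 * sin |y| + 2 * (π - 2 * |y|) * cos y) = 16 := by
    have : ∫ y in (-π)..(0:ℝ), (4 * sin |y| + 2 * (π - 2 * |y|) * cos y) =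
        ∫ y in (-π)..(0:ℝ), (-4 * sin y + 2 * (π + 2 * y) * cos y) := by
      refine integral_congr fun y hy => ?_
      rw [uIcc_of_le (by linarith)] at hy
      rw [abs_of_nonpos hy.2, Real.sin_neg]
      ring
    rw [this]
    have hG : ∀ y ∈ uIcc (-π) (0:ℝ), HasDerivAt (fun y => 8 * cos y + 2 * ((π + 2 * y) * sin y))
        (-4 * sin y + 2 * (π + 2 * y) * cos y) y := by
      intro y _
      have h1 := (hasDerivAt_cos y).const_mul 8
      have h2 : HasDerivAt (fun y => π + 2 * y) 2 y := by
        simpa using ((hasDerivAt_id y).const_mul 2).const_add π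
      have h3 := (h2.fun_mul (hasDerivAt_sin y)).const_mul 2
      refine (h1.fun_add h3).congr_deriv ?_
      ring
    rw [integral_eq_sub_of_hasDerivAt hG
      ((by fun_prop : Continuous fun y => -4 * sin y + 2 * (π + 2 * y) * cos y).intervalIntegrable
        (-π) 0)]
    norm_num [Real.cos_pi, Real.sin_pi, Real.cos_neg, Real.sin_neg]
  have := integral_add_adjacent_intervals (hi (-π) 0) (hi 0 π)
  linarith

/-- `∫_{-π}^{π} ∫_{-π}^{π} |cos x · cos y| dx dy = 16`. -/
theorem integral_integral_abs_cos_mul_cos :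
    ∫ y in (-π)..π, ∫ x in (-π)..π, |cos x * cos y| = 16 := by
  have h : ∀ y : ℝ, ∫ x in (-π)..π, |cos x * cos y| = 4 * |cos y| := by
    intro y
    simp_rw [abs_mul]
    rw [intervalIntegral.integral_mul_const, integral_abs_cos]
  simp_rw [h]
  rw [intervalIntegral.integral_const_mul, integral_abs_cos]
  norm_num

/-! ## 2. Iterated Brillouin-zone integrals of continuous functions -/

/-- `∫_{-π}^{π} ∫_{-π}^{π} f(x, y) dx dy` as an iterated interval integral. -/
def bzInt (f : ℝ → ℝ → ℝ) : ℝ := ∫ y in (-π)..π, ∫ x in (-π)..π, f x y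

/-- The inner zone integral `y ↦ ∫_{-π}^{π} f x y dx` of a jointly continuous `f` is continuous. -/
theorem continuous_inner_integral {f : ℝ → ℝ → ℝ} (hf : Continuous fun p : ℝ × ℝ => f p.1 p.2) :
    Continuous fun y => ∫ x in (-π)..π, f x y := by
  have h : Continuous ((fun p : ℝ × ℝ => f p.1 p.2) ∘ Prod.swap) := hf.comp continuous_swap
  exact intervalIntegral.continuous_parametric_intervalIntegral_of_continuous'
    (f := fun y x => f x y) h (-π) π

/-- Sections `x ↦ f x y` of a jointly continuous `f` are continuous. -/
theorem continuous_section {f : ℝ → ℝ → ℝ} (hf : Continuous fun p : ℝ × ℝ => f p.1 p.2) (y : ℝ) :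
    Continuous fun x => f x y := by
  have h : Continuous ((fun p : ℝ × ℝ => f p.1 p.2) ∘ fun x : ℝ => (x, y)) :=
    hf.comp (continuous_id.prodMk continuous_const)
  exact h

/-- `bzInt` is monotone on jointly continuous integrands. -/
theorem bzInt_mono {f g : ℝ → ℝ → ℝ} (hf : Continuous fun p : ℝ × ℝ => f p.1 p.2)
    (hg : Continuous fun p : ℝ × ℝ => g p.1 p.2) (h : ∀ x y, f x y ≤ g x y) :
    bzInt f ≤ bzInt g := by
  have hπ : -π ≤ π := by linarith [pi_pos]
  unfold bzInt
  refine intervalIntegral.integral_mono_on hπ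
    ((continuous_inner_integral hf).intervalIntegrable _ _)
    ((continuous_inner_integral hg).intervalIntegrable _ _) fun y _ => ?_
  exact intervalIntegral.integral_mono_on hπ ((continuous_section hf y).intervalIntegrable _ _)
    ((continuous_section hg y).intervalIntegrable _ _) fun x _ => h x y

/-- `bzInt` is additive on jointly continuous integrands. -/
theorem bzInt_add {f g : ℝ → ℝ → ℝ} (hf : Continuous fun p : ℝ × ℝ => f p.1 p.2)
    (hg : Continuous fun p : ℝ × ℝ => g p.1 p.2) :
    bzInt (fun x y => f x y + g x y) = bzInt f + bzInt g := by
  unfold bzInt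
  have inner : ∀ y, ∫ x in (-π)..π, (f x y + g x y) =
      (∫ x in (-π)..π, f x y) + ∫ x in (-π)..π, g x y :=
    fun y => integral_add ((continuous_section hf y).intervalIntegrable _ _)
      ((continuous_section hg y).intervalIntegrable _ _)
  simp_rw [inner]
  exact integral_add ((continuous_inner_integral hf).intervalIntegrable _ _)
    ((continuous_inner_integral hg).intervalIntegrable _ _)

/-- Scalars pull out of `bzInt`. -/
theorem bzInt_const_mul (c : ℝ) (f : ℝ → ℝ → ℝ) :
    bzInt (fun x y => c * f x y) = c * bzInt f := by
  unfold bzInt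
  simp_rw [intervalIntegral.integral_const_mul]

/-- Reflection through `π` in both variables leaves the iterated integral of a doubly
`2π`-periodic function invariant (one variable). -/
theorem integral_comp_pi_sub_of_periodic {F : ℝ → ℝ} (hF : Function.Periodic F (2 * π)) :
    ∫ x in (-π)..π, F (π - x) = ∫ x in (-π)..π, F x := by
  rw [intervalIntegral.integral_comp_sub_left]
  have h := hF.intervalIntegral_add_eq 0 (-π)
  rw [show (0:ℝ) + 2 * π = 2 * π by ring, show -π + 2 * π = π by ring] at h
  rw [show π - π = (0:ℝ) by ring, show π - -π = 2 * π by ring]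
  exact h

/-! ## 3. The kinetic symbol of the `t`–`t′` class, its `L¹` mass, bandwidth and merit -/

/-- The symbol of the direction-averaged kinetic operator of the square-lattice `t`–`t′` band at
`t = 1`, `s = t′/t`: `w_s(x, y) = 2(cos x + cos y) + 8 s cos x cos y`. -/
def kinSymbol (s x y : ℝ) : ℝ := 2 * (cos x + cos y) + 8 * s * (cos x * cos y)

/-- `kinL1 s = (2π)⁻² ∫_{-π}^{π}∫_{-π}^{π} |w_s|` (twice the maximal one-body kinetic-weight ceiling
`s_max(s)` of `bounds.tex` Thm 2, since `∫ w_s = 0`). -/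
def kinL1 (s : ℝ) : ℝ := bzInt (fun x y => |kinSymbol s x y|) / (2 * π) ^ 2

/-- The bandwidth (oscillation over the zone) of the kinetic symbol `w_s`: `max 8 (4 + 16|s|)`
(justified by `kinSymbol_sub_le_kinBandwidth` and `kinBandwidth_attained`). -/
def kinBandwidth (s : ℝ) : ℝ := max 8 (4 + 16 * |s|)

/-- The bandwidth-normalised merit of the one-body ceiling: `4 · kinL1 s / kinBandwidth s`
(`= 8 s_max(s) / W(s)`). -/
def merit (s : ℝ) : ℝ := 4 * kinL1 s / kinBandwidth s

/-- `w_s` is affine in `s`: `w_s = w_{s₀} + 8(s − s₀) cos x cos y`. -/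
theorem kinSymbol_affine (s s₀ x y : ℝ) :
    kinSymbol s x y = kinSymbol s₀ x y + 8 * (s - s₀) * (cos x * cos y) := by
  unfold kinSymbol; ring

/-- The zone shift `k ↦ (π, π) − k` turns `w_s` into `−w_{−s}`. -/
theorem kinSymbol_pi_sub (s x y : ℝ) :
    kinSymbol s (π - x) (π - y) = -kinSymbol (-s) x y := by
  simp only [kinSymbol, Real.cos_pi_sub]; ring

/-- `|w_{−s}(x, y)| = |w_s(π − x, π − y)|`. -/
theorem abs_kinSymbol_neg (s x y : ℝ) :
    |kinSymbol (-s) x y| = |kinSymbol s (π - x) (π - y)| := by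
  rw [kinSymbol_pi_sub, abs_neg]

/-- `w_s` is jointly continuous on the zone. -/
@[fun_prop]
theorem continuous_kinSymbol (s : ℝ) : Continuous fun p : ℝ × ℝ => kinSymbol s p.1 p.2 := by
  unfold kinSymbol
  fun_prop

/-- `|w_s|` is jointly continuous. -/
theorem continuous_abs_kinSymbol (s : ℝ) : Continuous fun p : ℝ × ℝ => |kinSymbol s p.1 p.2| :=
  (continuous_kinSymbol s).abs

/-- `c · |w_s|` is jointly continuous. -/
theorem continuous_const_mul_abs_kinSymbol (c s : ℝ) :
    Continuous fun p : ℝ × ℝ => c * |kinSymbol s p.1 p.2| :=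
  continuous_const.fun_mul (continuous_kinSymbol s).abs

end

end Summit.HubbardSuperconductivity.HubbardLadder.Bounds
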